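import Mathlib
import HarnessLib
import Literature.AlgebraicGeometry.HyperbolicPolynomials.SpectrahedralShadow
import Summits.ValiantsHypothesis.ValiantsHypothesis.Theorems.PermanentalConesHyperbolicVPShadowStubRealifyHermitianPencil
import Summits.ValiantsHypothesis.ValiantsHypothesis.Theorems.PermanentalConesHyperbolicVPShadowStubSpectrahedronOfSymmDetPower

/-!
# ValiantsHypothesis / PermanentalCones — `HyperbolicVPShadow`, stub D₅ʰ

Route `PermanentalCones`, item `stmt-ValiantsHypothesis-8655` (crux `HyperbolicVPShadow`), line
`birth`, stub `stub_oshimeFamilyD5h_spectrahedron`.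

Family (D5) of Oshime's classification of non-symmetrisable linear pencils of real `3 × 3`
matrices with only real eigenvalues (Oshime 1991, part (II), Prop. 5.19 / Thm. 6.3 (5)), in
homogenised form, is the `4`-variable pencil `P(x) = x₀ 1 + x₁ A + x₂ B + x₃ C` with
`A = E₁₁ + E₂₃ = !![1, 0, 0; 0, 0, 1; 0, 0, 0]`, `B = !![ρ, 1, −a; a, 0, 0; −1, 0, 0]`,
`C = !![σ, b, γ − δ; γ + δ, 1, 0; b, 0, −1]`, where `0 < b < 1`,
`ρ = (1 − 1/b²) γ + a b + (a − 1)/b` and `σ = (b + 1/b) δ`; it has only real eigenvalues iff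
`a b + γ ≥ 0` and `(γ + (1 − a) b)² + b² δ² ≤ b² (a b + γ)²`. We show that under these hypotheses
its closed nonnegative-spectrum cone `{x : ∀ τ > 0, det (P x + τ·1) ≠ 0}` is a lifted-LMI set
of size `6`.

## Proof

The admissible parameters are *polynomially parametrised*: there are reals `P₁, P₂, S` with
`a = ((1 − b)((1 + b) P₁² + (1 − b) P₂² + 2 S²) + 1)/2`, `γ = b(1 − b)(P₁² + P₂² + 2 S²) − a b`,
`δ = 2 b (1 − b)(P₁ P₂ − S²)` (`permanentalCones_oshimeD5_certificate`; with `u := P₁ + P₂`,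
`w := P₂ − P₁` these say `b(1−b) u² = ab + γ + δ`, `b(1−b)(w² + 4S²) = ab + γ − δ`,
`b²(1−b) u w = γ + (1−a) b`, solvable exactly under the two hypotheses), and then
`ρ = (1 − b)((b + 1) P₁² + (b − 1) P₂² + 2 b S²)`, `σ = 2 (b² + 1)(1 − b)(P₁ P₂ − S²)`.
With `κ² = 1 − b²` and `t := τ + x₀` the *Hermitian* matrix
`H = !![t + x₁ + ρ x₂ + σ x₃, conj v₁, conj v₂; v₁, t + x₂, κ x₃; v₂, κ x₃, t − x₂]`,
`v₁ := κ ((P₁ + S i) x₂ + b (P₂ − S i) x₃)`, `v₂ := (1 − b)((P₂ − S i) x₂ + b (P₁ + S i) x₃)`,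
satisfies `det H = det (P x + τ·1)` identically: a polynomial identity modulo `κ² = 1 − b²`
and `i² = −1` (`permanentalCones_oshimeD5_polyIdentity`, `permanentalCones_oshimeD5_detIdentity`).
Realifying the Hermitian pencil (`stub_realify_hermitianPencil`) gives a real symmetric pencil
`L` of size `2·3` with `det (L x + τ·1) = det (P x + τ·1)²`, and
`stub_spectrahedron_of_symmDetPower` (`k = 2`) turns this into a size-`6` lifted-LMI description
of the cone. No definitions are introduced: all matrices are literals, the two pencils are
`Fintype.linearCombination ℝ ![…]`.
-/

-- `<Problem> = <Summit>` for this single-conjunct summit (lakefile sets the same option tree-wide).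
set_option linter.dupNamespace false

namespace Summit.ValiantsHypothesis.ValiantsHypothesis.Theorems

open Matrix Complex

/-- **Parameters of the Hermitian certificate for Oshime's family (D5).** If `0 < b < 1`,
`0 ≤ a b + γ` and `(γ + (1 − a) b)² + b² δ² ≤ b² (a b + γ)²`, then there are reals `P₁, P₂, S`
with `a = ((1 − b)((1 + b) P₁² + (1 − b) P₂² + 2 S²) + 1)/2`,
`γ = b (1 − b)(P₁² + P₂² + 2 S²) − a b` and `δ = 2 b (1 − b)(P₁ P₂ − S²)`
(certificate for Oshime 1991 (II), Prop. 5.19, family (D5)). [folklore] -/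
theorem permanentalCones_oshimeD5_certificate (a b γ δ : ℝ) (hb0 : 0 < b) (hb1 : b < 1)
    (hU : 0 ≤ a * b + γ)
    (hV : (γ + (1 - a) * b) ^ 2 + b ^ 2 * δ ^ 2 ≤ b ^ 2 * (a * b + γ) ^ 2) :
    ∃ P₁ P₂ S : ℝ,
      a = ((1 - b) * ((1 + b) * P₁ ^ 2 + (1 - b) * P₂ ^ 2 + 2 * S ^ 2) + 1) / 2 ∧
      γ = b * (1 - b) * (P₁ ^ 2 + P₂ ^ 2 + 2 * S ^ 2) - a * b ∧
      δ = 2 * b * (1 - b) * (P₁ * P₂ - S ^ 2) := by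
  obtain ⟨c, hc⟩ : ∃ c : ℝ, c = b * (1 - b) := ⟨_, rfl⟩
  have hc0 : 0 < c := by rw [hc]; exact mul_pos hb0 (by linarith)
  -- `|δ| ≤ a b + γ`
  have hδU : δ ^ 2 ≤ (a * b + γ) ^ 2 := by
    nlinarith [sq_nonneg (γ + (1 - a) * b), mul_pos hb0 hb0]
  obtain ⟨hδ1, hδ2⟩ := abs_le_of_sq_le_sq' hδU hU
  have hp0 : 0 ≤ a * b + γ + δ := by linarith
  have hq0 : 0 ≤ a * b + γ - δ := by linarith
  -- `u = P₁ + P₂`, `w = P₂ - P₁`, `q = (a b + γ - δ) / c`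
  obtain ⟨u, hu⟩ : ∃ u : ℝ, u ^ 2 = (a * b + γ + δ) / c :=
    ⟨Real.sqrt _, Real.sq_sqrt (div_nonneg hp0 hc0.le)⟩
  have F1 : c * u ^ 2 = a * b + γ + δ := by
    rw [hu, ← mul_div_assoc, mul_div_cancel_left₀ _ hc0.ne']
  obtain ⟨q, hq⟩ : ∃ q : ℝ, q = (a * b + γ - δ) / c := ⟨_, rfl⟩
  have Fq : c * q = a * b + γ - δ := by
    rw [hq, ← mul_div_assoc, mul_div_cancel_left₀ _ hc0.ne']
  obtain ⟨w, hw⟩ : ∃ w : ℝ, w = (γ + (1 - a) * b) * u / (b * (a * b + γ + δ)) := ⟨_, rfl⟩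
  have F3w : b * c * (u * w) = γ + (1 - a) * b ∧ w ^ 2 ≤ q := by
    rcases eq_or_lt_of_le hp0 with h0 | hpos
    · -- degenerate case `a b + γ + δ = 0`: then `γ + (1 - a) b = 0` and `w = 0`
      have hδ' : δ = -(a * b + γ) := by linarith
      have hV2 : (γ + (1 - a) * b) ^ 2 ≤ 0 := by
        have h := hV
        rw [hδ'] at h
        linarith
      have hV0 : γ + (1 - a) * b = 0 :=
        pow_eq_zero_iff (n := 2) two_ne_zero |>.1 (le_antisymm hV2 (sq_nonneg _))
      have hw0 : w = 0 := by rw [hw, ← h0, mul_zero, div_zero]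
      refine ⟨by rw [hw0, hV0]; ring, ?_⟩
      rw [hw0, hq]
      simpa using div_nonneg hq0 hc0.le
    · have F3 : b * c * (u * w) = γ + (1 - a) * b := by
        rw [hw, show b * c * (u * ((γ + (1 - a) * b) * u / (b * (a * b + γ + δ)))) =
          b * (c * u ^ 2) * (γ + (1 - a) * b) / (b * (a * b + γ + δ)) by ring, F1]
        exact mul_div_cancel_left₀ _ (mul_ne_zero hb0.ne' hpos.ne')
      refine ⟨F3, ?_⟩
      -- `b² (ab + γ + δ) · c (q - w²) = b² ((ab + γ)² - δ²) - (γ + (1 - a) b)² ≥ 0`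
      have key : b ^ 2 * (a * b + γ + δ) * (c * (q - w ^ 2)) =
          b ^ 2 * ((a * b + γ + δ) * (a * b + γ - δ)) - (γ + (1 - a) * b) ^ 2 := by
        rw [← F1, ← Fq, ← F3]; ring
      have h1 : 0 ≤ b ^ 2 * (a * b + γ + δ) * (c * (q - w ^ 2)) := by rw [key]; linarith
      have h2 := (mul_nonneg_iff_of_pos_left (mul_pos (pow_pos hb0 2) hpos)).1 h1
      linarith [(mul_nonneg_iff_of_pos_left hc0).1 h2]
  obtain ⟨F3, hw2⟩ := F3w
  obtain ⟨S, hS⟩ : ∃ S : ℝ, 4 * S ^ 2 = q - w ^ 2 :=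
    ⟨Real.sqrt (q - w ^ 2) / 2, by rw [div_pow, Real.sq_sqrt (sub_nonneg.2 hw2)]; ring⟩
  have F2 : c * (w ^ 2 + 4 * S ^ 2) = a * b + γ - δ := by rw [hS]; linear_combination Fq
  subst hc
  refine ⟨(u - w) / 2, (u + w) / 2, S, ?_, ?_, ?_⟩
  · -- multiply by `b ≠ 0`
    have key : b * (2 * a) = b * ((1 - b) * ((1 + b) * ((u - w) / 2) ^ 2 +
        (1 - b) * ((u + w) / 2) ^ 2 + 2 * S ^ 2) + 1) := by
      linear_combination (-1 / 2 : ℝ) * F1 + (-1 / 2 : ℝ) * F2 + F3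
    have h2a := mul_left_cancel₀ hb0.ne' key
    linear_combination (1 / 2 : ℝ) * h2a
  · linear_combination (-1 / 2 : ℝ) * F1 + (-1 / 2 : ℝ) * F2
  · linear_combination (-1 / 2 : ℝ) * F1 + (1 / 2 : ℝ) * F2

/-- **The polynomial identity behind the Hermitian certificate for family (D5).** Over `ℂ`, with
`a, γ, δ, ρ, σ` the polynomial expressions of the certificate in `b, P₁, P₂, S` and
`κ² = 1 − b²`, the determinant of the Hermitian-shaped matrix
`!![T + x₁ + ρ x₂ + σ x₃, conj v₁, conj v₂; v₁, T + x₂, κ x₃; v₂, κ x₃, T − x₂]`,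
`v₁ = κ ((P₁ + S i) x₂ + b (P₂ − S i) x₃)`, `v₂ = (1 − b)((P₂ − S i) x₂ + b (P₁ + S i) x₃)`, equals
`det (T·1 + x₁ A + x₂ B + x₃ C)` for Oshime's family (D5) (Oshime 1991 (II), Prop. 5.19); the
difference is an explicit combination of `κ² − (1 − b²)` and `i² + 1`. [folklore] -/
theorem permanentalCones_oshimeD5_polyIdentity (T x₁ x₂ x₃ a b γ δ ρ σ κ P₁ P₂ S : ℂ)
    (hκ : κ ^ 2 = 1 - b ^ 2)
    (ha : a = ((1 - b) * ((1 + b) * P₁ ^ 2 + (1 - b) * P₂ ^ 2 + 2 * S ^ 2) + 1) / 2)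
    (hγ : γ = b * (1 - b) * (P₁ ^ 2 + P₂ ^ 2 + 2 * S ^ 2) - a * b)
    (hδ : δ = 2 * b * (1 - b) * (P₁ * P₂ - S ^ 2))
    (hρ : ρ = (1 - b) * ((b + 1) * P₁ ^ 2 + (b - 1) * P₂ ^ 2 + 2 * b * S ^ 2))
    (hσ : σ = 2 * (b ^ 2 + 1) * (1 - b) * (P₁ * P₂ - S ^ 2)) :
    (!![T + x₁ + ρ * x₂ + σ * x₃, κ * ((P₁ - S * I) * x₂ + b * (P₂ + S * I) * x₃),
          (1 - b) * ((P₂ + S * I) * x₂ + b * (P₁ - S * I) * x₃);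
        κ * ((P₁ + S * I) * x₂ + b * (P₂ - S * I) * x₃), T + x₂, κ * x₃;
        (1 - b) * ((P₂ - S * I) * x₂ + b * (P₁ + S * I) * x₃), κ * x₃, T - x₂]).det =
      (!![T + x₁ + ρ * x₂ + σ * x₃, x₂ + b * x₃, -a * x₂ + (γ - δ) * x₃;
          a * x₂ + (γ + δ) * x₃, T + x₃, x₁; -x₂ + b * x₃, 0, T - x₃]).det := by
  subst hδ hγ hσ hρ
  subst ha
  simp only [Matrix.det_fin_three, Matrix.of_apply, Matrix.cons_val', Matrix.cons_val_zero,
    Matrix.cons_val_one, Matrix.cons_val_two, Matrix.head_cons, Matrix.tail_cons,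
    Matrix.empty_val', Matrix.cons_val_fin_one, Matrix.head_fin_const]
  -- the coefficient of `κ² - (1 - b²)` is the `κ²`-part of the Hermitian expansion, the
  -- coefficient of `I² + 1` collects the `S²`-terms of `|v₁|²`, `|v₂|²` and `2 Re (v₁⋆ κ x₃ v₂)`
  linear_combination
    (-((T + x₁ + (1 - b) * ((b + 1) * P₁ ^ 2 + (b - 1) * P₂ ^ 2 + 2 * b * S ^ 2) * x₂
          + 2 * (b ^ 2 + 1) * (1 - b) * (P₁ * P₂ - S ^ 2) * x₃) * x₃ ^ 2)
      - (T - x₂) * ((P₁ * x₂ + b * P₂ * x₃) ^ 2 - I ^ 2 * (S * (x₂ - b * x₃)) ^ 2)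
      + (1 - b) * x₃ * (2 * (P₁ * x₂ + b * P₂ * x₃) * (P₂ * x₂ + b * P₁ * x₃)
          + 2 * I ^ 2 * (S * (x₂ - b * x₃)) ^ 2)) * hκ
    + (2 * (1 - b) * S ^ 2 * (x₂ - b * x₃) ^ 2 * (T - b * x₂ + (1 - b ^ 2) * x₃)) * I_sq

/-- **The Hermitian determinantal identity for Oshime's family (D5).** Under the relations of
`permanentalCones_oshimeD5_certificate` (and the resulting polynomial forms of `ρ`, `σ`) and
`κ² = 1 − b²`, `det (t·1 + x₀·1 + x₁ E₁₁ + x₂ G₂ + x₃ G₃) = det (t·1 + x₀·1 + x₁ A + x₂ B + x₃ C)`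
for the Hermitian matrices `G₂ = !![ρ, κ (P₁ − S i), (1 − b)(P₂ + S i); ⋯; ⋯]`,
`G₃ = !![σ, κ b (P₂ + S i), (1 − b) b (P₁ − S i); ⋯, 0, κ; ⋯, κ, 0]`, both sides written out as
explicit `3 × 3` matrices (Oshime 1991 (II), Prop. 5.19, family (D5)). [folklore] -/
theorem permanentalCones_oshimeD5_detIdentity (a b γ δ ρ σ κ P₁ P₂ S : ℝ)
    (hκ : κ ^ 2 = 1 - b ^ 2)
    (ha : a = ((1 - b) * ((1 + b) * P₁ ^ 2 + (1 - b) * P₂ ^ 2 + 2 * S ^ 2) + 1) / 2)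
    (hγ : γ = b * (1 - b) * (P₁ ^ 2 + P₂ ^ 2 + 2 * S ^ 2) - a * b)
    (hδ : δ = 2 * b * (1 - b) * (P₁ * P₂ - S ^ 2))
    (hρ : ρ = (1 - b) * ((b + 1) * P₁ ^ 2 + (b - 1) * P₂ ^ 2 + 2 * b * S ^ 2))
    (hσ : σ = 2 * (b ^ 2 + 1) * (1 - b) * (P₁ * P₂ - S ^ 2)) (t x₀ x₁ x₂ x₃ : ℝ) :
    (!![(t : ℂ) + x₀ + x₁ + ρ * x₂ + σ * x₃, κ * ((P₁ - S * I) * x₂ + b * (P₂ + S * I) * x₃),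
          (1 - b) * ((P₂ + S * I) * x₂ + b * (P₁ - S * I) * x₃);
        κ * ((P₁ + S * I) * x₂ + b * (P₂ - S * I) * x₃), t + x₀ + x₂, κ * x₃;
        (1 - b) * ((P₂ - S * I) * x₂ + b * (P₁ + S * I) * x₃), κ * x₃, t + x₀ - x₂]).det =
      ((!![t + x₀ + x₁ + ρ * x₂ + σ * x₃, x₂ + b * x₃, -a * x₂ + (γ - δ) * x₃;
          a * x₂ + (γ + δ) * x₃, t + x₀ + x₃, x₁; -x₂ + b * x₃, 0, t + x₀ - x₃]).det : ℂ) := by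
  have h := permanentalCones_oshimeD5_polyIdentity ((t : ℂ) + x₀) x₁ x₂ x₃ a b γ δ ρ σ κ P₁ P₂ S
    (by exact_mod_cast hκ) (by exact_mod_cast ha) (by exact_mod_cast hγ) (by exact_mod_cast hδ)
    (by exact_mod_cast hρ) (by exact_mod_cast hσ)
  simp only [Matrix.det_fin_three, Matrix.of_apply, Matrix.cons_val', Matrix.cons_val_zero,
    Matrix.cons_val_one, Matrix.cons_val_two, Matrix.head_cons, Matrix.tail_cons,
    Matrix.empty_val', Matrix.cons_val_fin_one, Matrix.head_fin_const] at h ⊢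
  push_cast at h ⊢
  linear_combination h

/-- **Stub (Oshime's family (D5), homogenised, has size-`6` spectrahedral cones).** For
`0 < b < 1`, `0 ≤ a b + γ` and `(γ + (1 − a) b)² + b² δ² ≤ b² (a b + γ)²`, the closed
nonnegative-spectrum cone `{x : ∀ τ > 0, det (x₀ 1 + x₁ A + x₂ B + x₃ C + τ·1) ≠ 0}` of the
real-spectrum pencil `A = E₁₁ + E₂₃`, `B = !![ρ, 1, −a; a, 0, 0; −1, 0, 0]`,
`C = !![σ, b, γ − δ; γ + δ, 1, 0; b, 0, −1]`, `ρ = (1 − 1/b²) γ + a b + (a − 1)/b`,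
`σ = (b + 1/b) δ` (Oshime 1991 (II), Prop. 5.19 / Thm. 6.3 (5), family (D5)) is a lifted-LMI
set of size `6`: a Hermitian `3 × 3` determinantal representation, realified to a symmetric
`6 × 6` representation of the square of `det (P x + τ·1)`. [folklore] -/
theorem stub_oshimeFamilyD5h_spectrahedron :
    ∀ a b γ δ : ℝ, 0 < b → b < 1 → 0 ≤ a * b + γ →
      (γ + (1 - a) * b) ^ 2 + b ^ 2 * δ ^ 2 ≤ b ^ 2 * (a * b + γ) ^ 2 →
      Literature.AlgebraicGeometry.HyperbolicPolynomials.IsSpectrahedralShadowOfSize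
        {x : Fin 4 → ℝ | ∀ τ : ℝ, 0 < τ →
          (x 0 • (1 : Matrix (Fin 3) (Fin 3) ℝ) + x 1 • !![(1 : ℝ), 0, 0; 0, 0, 1; 0, 0, 0] +
            x 2 • !![(1 - 1 / b ^ 2) * γ + a * b + (a - 1) / b, 1, -a; a, 0, 0; -1, 0, 0] +
            x 3 • !![(b + 1 / b) * δ, b, γ - δ; γ + δ, 1, 0; b, 0, -1] +
            τ • (1 : Matrix (Fin 3) (Fin 3) ℝ)).det ≠ 0} 6 := by
  intro a b γ δ hb0 hb1 hU hV
  obtain ⟨P₁, P₂, S, ha, hγ, hδ⟩ := permanentalCones_oshimeD5_certificate a b γ δ hb0 hb1 hU hV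
  obtain ⟨κ, hκ⟩ : ∃ κ : ℝ, κ ^ 2 = 1 - b ^ 2 := ⟨Real.sqrt _, Real.sq_sqrt (by nlinarith)⟩
  obtain ⟨ρ, hρ⟩ : ∃ ρ : ℝ, ρ = (1 - 1 / b ^ 2) * γ + a * b + (a - 1) / b := ⟨_, rfl⟩
  obtain ⟨σ, hσ⟩ : ∃ σ : ℝ, σ = (b + 1 / b) * δ := ⟨_, rfl⟩
  have hb : b ≠ 0 := hb0.ne'
  -- the polynomial forms of `ρ` and `σ`
  have hρ' : ρ = (1 - b) * ((b + 1) * P₁ ^ 2 + (b - 1) * P₂ ^ 2 + 2 * b * S ^ 2) := by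
    rw [hρ, hγ, ha]
    field_simp
    ring
  have hσ' : σ = 2 * (b ^ 2 + 1) * (1 - b) * (P₁ * P₂ - S ^ 2) := by
    rw [hσ, hδ]
    field_simp
  -- the real pencil `P x = x 0 • 1 + x 1 • A + x 2 • B + x 3 • C`
  let P : (Fin 4 → ℝ) →ₗ[ℝ] Matrix (Fin 3) (Fin 3) ℝ := Fintype.linearCombination ℝ
    ![(1 : Matrix (Fin 3) (Fin 3) ℝ), !![(1 : ℝ), 0, 0; 0, 0, 1; 0, 0, 0],
      !![(1 - 1 / b ^ 2) * γ + a * b + (a - 1) / b, 1, -a; a, 0, 0; -1, 0, 0],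
      !![(b + 1 / b) * δ, b, γ - δ; γ + δ, 1, 0; b, 0, -1]]
  have hP : ∀ x : Fin 4 → ℝ, P x = x 0 • (1 : Matrix (Fin 3) (Fin 3) ℝ) +
      x 1 • !![(1 : ℝ), 0, 0; 0, 0, 1; 0, 0, 0] +
      x 2 • !![(1 - 1 / b ^ 2) * γ + a * b + (a - 1) / b, 1, -a; a, 0, 0; -1, 0, 0] +
      x 3 • !![(b + 1 / b) * δ, b, γ - δ; γ + δ, 1, 0; b, 0, -1] := fun x => by
    simp only [P, Fintype.linearCombination_apply, Fin.sum_univ_four, Matrix.cons_val_zero,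
      Matrix.cons_val_one, Matrix.cons_val_two, Matrix.cons_val, Matrix.head_cons,
      Matrix.tail_cons]
  have hPx : ∀ (x : Fin 4 → ℝ) (τ : ℝ), P x + τ • (1 : Matrix (Fin 3) (Fin 3) ℝ) =
      !![τ + x 0 + x 1 + ρ * x 2 + σ * x 3, x 2 + b * x 3, -a * x 2 + (γ - δ) * x 3;
        a * x 2 + (γ + δ) * x 3, τ + x 0 + x 3, x 1;
        -x 2 + b * x 3, 0, τ + x 0 - x 3] := fun x τ => by
    rw [hP, hρ, hσ]
    ext i j
    fin_cases i <;> fin_cases j <;> simp <;> ring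
  -- the Hermitian pencil `H x = x 0 • 1 + x 1 • E₁₁ + x 2 • G₂ + x 3 • G₃`
  let G₁ : Matrix (Fin 3) (Fin 3) ℂ := !![1, 0, 0; 0, 0, 0; 0, 0, 0]
  let G₂ : Matrix (Fin 3) (Fin 3) ℂ :=
    !![(ρ : ℂ), κ * (P₁ - S * I), (1 - b) * (P₂ + S * I);
      κ * (P₁ + S * I), 1, 0; (1 - b) * (P₂ - S * I), 0, -1]
  let G₃ : Matrix (Fin 3) (Fin 3) ℂ :=
    !![(σ : ℂ), κ * b * (P₂ + S * I), (1 - b) * b * (P₁ - S * I);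
      κ * b * (P₂ - S * I), 0, κ; (1 - b) * b * (P₁ + S * I), κ, 0]
  have h1h : (1 : Matrix (Fin 3) (Fin 3) ℂ).IsHermitian := Matrix.isHermitian_one
  have hG₁h : G₁.IsHermitian := Matrix.IsHermitian.ext fun i j => by
    fin_cases i <;> fin_cases j <;> simp [G₁]
  have hG₂h : G₂.IsHermitian := Matrix.IsHermitian.ext fun i j => by
    fin_cases i <;> fin_cases j <;> simp [G₂, Complex.ext_iff]
  have hG₃h : G₃.IsHermitian := Matrix.IsHermitian.ext fun i j => by
    fin_cases i <;> fin_cases j <;> simp [G₃, Complex.ext_iff]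
  let H : (Fin 4 → ℝ) →ₗ[ℝ] Matrix (Fin 3) (Fin 3) ℂ :=
    Fintype.linearCombination ℝ ![(1 : Matrix (Fin 3) (Fin 3) ℂ), G₁, G₂, G₃]
  have hH : ∀ x : Fin 4 → ℝ, H x = x 0 • (1 : Matrix (Fin 3) (Fin 3) ℂ) + x 1 • G₁ + x 2 • G₂ +
      x 3 • G₃ := fun x => by
    simp only [H, Fintype.linearCombination_apply, Fin.sum_univ_four, Matrix.cons_val_zero,
      Matrix.cons_val_one, Matrix.cons_val_two, Matrix.cons_val, Matrix.head_cons,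
      Matrix.tail_cons]
  have hHerm : ∀ x : Fin 4 → ℝ, (H x).IsHermitian := fun x => by
    rw [hH]
    exact (((h1h.smul (IsSelfAdjoint.all _)).add (hG₁h.smul (IsSelfAdjoint.all _))).add
      (hG₂h.smul (IsSelfAdjoint.all _))).add (hG₃h.smul (IsSelfAdjoint.all _))
  have hHx : ∀ (x : Fin 4 → ℝ) (τ : ℝ), H x + (τ : ℂ) • (1 : Matrix (Fin 3) (Fin 3) ℂ) =
      !![(τ : ℂ) + x 0 + x 1 + ρ * x 2 + σ * x 3,
          κ * ((P₁ - S * I) * x 2 + b * (P₂ + S * I) * x 3),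
          (1 - b) * ((P₂ + S * I) * x 2 + b * (P₁ - S * I) * x 3);
        κ * ((P₁ + S * I) * x 2 + b * (P₂ - S * I) * x 3), τ + x 0 + x 2, κ * x 3;
        (1 - b) * ((P₂ - S * I) * x 2 + b * (P₁ + S * I) * x 3), κ * x 3, τ + x 0 - x 2] :=
    fun x τ => by
    rw [hH]
    ext i j
    fin_cases i <;> fin_cases j <;> simp [G₁, G₂, G₃, Matrix.smul_apply] <;> ring
  -- the determinantal identity `det (H x + τ·1) = det (P x + τ·1)`
  have hdet : ∀ (x : Fin 4 → ℝ) (τ : ℝ), (H x + (τ : ℂ) • (1 : Matrix (Fin 3) (Fin 3) ℂ)).det =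
      (((P x + τ • (1 : Matrix (Fin 3) (Fin 3) ℝ)).det : ℝ) : ℂ) := fun x τ => by
    rw [hHx, hPx]
    exact permanentalCones_oshimeD5_detIdentity a b γ δ ρ σ κ P₁ P₂ S hκ ha hγ hδ hρ' hσ' τ (x 0)
      (x 1) (x 2) (x 3)
  -- realification: a symmetric pencil of size `2·3` representing the square of `det (P x + τ·1)`
  obtain ⟨L, hLsymm, hLdet⟩ := stub_realify_hermitianPencil 4 3 H hHerm
  have hLdet' : ∀ (x : Fin 4 → ℝ) (τ : ℝ),
      (L x + τ • (1 : Matrix (Fin (2 * 3)) (Fin (2 * 3)) ℝ)).det =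
        ((P x + τ • (1 : Matrix (Fin 3) (Fin 3) ℝ)).det) ^ 2 := fun x τ => by
    have h := hLdet x τ
    simp only [Complex.coe_algebraMap] at h
    have hs : star (((P x + τ • (1 : Matrix (Fin 3) (Fin 3) ℝ)).det : ℝ) : ℂ) =
        ((P x + τ • (1 : Matrix (Fin 3) (Fin 3) ℝ)).det : ℝ) := Complex.conj_ofReal _
    rw [hdet x τ, hs, ← Complex.ofReal_mul] at h
    rw [sq]
    exact_mod_cast h
  have h6 := stub_spectrahedron_of_symmDetPower 4 3 (2 * 3) 2 P L two_ne_zero hLsymm hLdet'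
  simp only [hP] at h6
  exact h6

end Summit.ValiantsHypothesis.ValiantsHypothesis.Theorems
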